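import Summits.RiemannHypothesis.RiemannHypothesis.Theses.ShiftedResolvent
import Literature.NumberTheory.LFunctions.WeilResolventVectorExists

/-!
# Birth skeleton PREPARED for the REPAIRED crux `ResolventRealZeros` of route `ShiftedResolvent`
# (item stmt-RiemannHypothesis-15969) — NOT REGISTERED: it concludes `ResolventRealZerosR`, the
# correctly parenthesised statement, not the route decl as currently rendered (rev 2), which is
# refuted as typed (`AsTypedRefutation.lean` in this crux directory, `not_resolventRealZeros`, rc 0,
# no sorry: parse trap `lam * ∫ t, ‖h t‖ ^ 2 - 2 * …`).

`ResolventRealZerosR` below is the crux the route MEANS (its docstring, the refuter's read-back and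
both grounders' notes all describe this statement): for `a > 0`, `lam < ε(a)` and every
shifted-resolvent vector `v` (`Literature.NumberTheory.LFunctions.IsWeilResolventVector a lam v`, the
landed predicate = the inline IsRes text WITH the parentheses `lam * (∫ t, ‖h t‖ ^ 2)`,
`isWeilResolventVector_iff` is `Iff.rfl`), `v̂ = weilMellin v` is entire and all its zeros lie on
`Re s = 1/2`. `resolventRealZerosR_iff_inline` is the `Iff.rfl` read-back against the inline text a
`ledger route edit … --restate ResolventRealZeros --statement '…'` (or a repaired item
`ResolventRealZerosR`) should carry. Once the route decl is re-rendered with the parentheses, replace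
`ResolventRealZerosR` by the route decl (the composition below then concludes the crux BY NAME,
definitionally) and register with `ledger skeleton check … --crux stmt-RiemannHypothesis-15969`.

LINE (crux ideas `resolvent-is-renormalised-ground-state` (idea-node g11) ≡
`phase-rotated-factor-exchange` (idea-node g7), merged; evidence on the item): the resolvent vector
`v = (A_a − λ)⁻¹ 1` is the GAPPED SIMPLE BOTTOM (value `0`, gap `ε(a) − λ`) of the RENORMALISED form
`Q'(g) = Re Q(g) − λ ‖g‖₂² − |ĝ(1/2)|² / A`, `A = Re v̂(1/2) = ⟨(A_a − λ)⁻¹1, 1⟩ > 0` (tree: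
`IsWeilResolventVector.re_weilMellin_half_pos`), because in Suzuki's Hilbert space `H(T_{a,λ})`
(‖g‖²_T = Re Q(g) − λ‖g‖², arXiv:2606.09096 §1.2 (1.9)) one has `⟨g, v⟩_T = ⟨g, 1⟩ = ĝ(1/2)` and
`‖v‖²_T = A`, so `Q'(g) = ‖g − (ĝ(1/2)/A) v‖²_T ≥ (ε(a) − λ)·dist_{L²}(g, ℂ v)²` (Cauchy–Schwarz +
coercivity). `Q'` is still a functional of the kernel `g ⋆ g̃` alone (`|ĝ(1/2)|² = (g ⋆ g̃)^(1/2)`),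
so the tree's sorry-free CONTINUUM Connes–van Suijlekom argument for ground states
(`WeilGroundStateRealZerosProofs.lean`: translation identity `Q(V' − cV) = Q(V' + c̄V)` §D,
pinned-zero minimising sequences and primitives §C, gap §B, Volterra/Gronwall + Lebesgue
differentiation §E; evenness unused) re-runs with `q ↦ Q'`, `u ↦ v/‖v‖`, contradiction `v = 0`
a.e. against `A > 0` instead of `‖u‖ = 1`. No de Branges space, no operator is posited.

Stubs (tree convention, cf. `Cruxes/AhfHighReal/Lines/birth.lean`: statements as named props
`Sig.stub_*`; registered stubs `stub_*` spelled out verbatim, `sorry` ONLY there; composition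
`ResolventRealZerosR_of` sorry-free; `ResolventRealZerosR_proof` the skeleton theorem):
* `stub_resolventGap` (§B analogue, size M/L) — the gap inequality for `Q'` in the direction `v`;
* `stub_modifiedSeq` (§C analogue, size M) — a zero `v̂(s₀) = 0` gives window tests `g_m → v` in
  `L²` with `ĝ_m(s₀) = 0` and `Q'(g_m) → 0` (uses `inf J_λ = −A`, tree `re_weilMellin_half`);
* `stub_factorExchange` (§D–§E analogue, size L, HARDEST) — with `A > 0` and the gap, such a
  pinned sequence cannot exist off the line `Re s₀ = 1/2`.
Mind the parentheses `(∫ t, ‖g t‖ ^ 2)` everywhere below (the very trap that sank rev 2).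
-/

noncomputable section

namespace Summit.RiemannHypothesis.RiemannHypothesis.Cruxes.ResolventRealZeros.BirthRepaired

open MeasureTheory Filter Set
open scoped Topology ComplexConjugate
open _root_.Literature.NumberTheory.LFunctions

/-- **The REPAIRED crux** (what item 15969 means): for `a > 0`, `lam < ε(a)` and every
shifted-resolvent vector `v` of the window `[-a, a]` at the shift `lam`, `weilMellin v` is entire
and all its zeros have real part `1/2`. -/
def ResolventRealZerosR : Prop :=
  ∀ a : ℝ, 0 < a → ∀ lam : ℝ, lam < weilGroundEnergy a → ∀ v : ℝ → ℂ,
    IsWeilResolventVector a lam v →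
      Differentiable ℂ (weilMellin v) ∧ ∀ s : ℂ, weilMellin v s = 0 → s.re = 1 / 2

/-- Read-back (`Iff.rfl`): `ResolventRealZerosR` is the route text of `ResolventRealZeros` with the
parentheses `lam * (∫ t, ‖h t‖ ^ 2)` / `lam * (∫ t, ‖g n t‖ ^ 2)` inserted — the exact
`--statement` for the restate. -/
theorem resolventRealZerosR_iff_inline :
    ResolventRealZerosR ↔
      ∀ a : ℝ, 0 < a → ∀ lam : ℝ, lam < Literature.NumberTheory.LFunctions.weilGroundEnergy a → ∀ v : ℝ → ℂ, (MemLp v 2 ∧ ∃ g : ℕ → ℝ → ℂ, (∀ n, Literature.NumberTheory.LFunctions.IsWeilTest (g n) ∧ tsupport (g n) ⊆ Icc (-a) a) ∧ (∃ m : ℝ, (∀ h : ℝ → ℂ, Literature.NumberTheory.LFunctions.IsWeilTest h → tsupport h ⊆ Icc (-a) a → m ≤ (Literature.NumberTheory.LFunctions.weilQuadratic h).re - lam * (∫ t, ‖h t‖ ^ 2) - 2 * (Literature.NumberTheory.LFunctions.weilMellin h (1 / 2)).re) ∧ Tendsto (fun n => (Literature.NumberTheory.LFunctions.weilQuadratic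 (g n)).re - lam * (∫ t, ‖g n t‖ ^ 2) - 2 * (Literature.NumberTheory.LFunctions.weilMellin (g n) (1 / 2)).re) atTop (𝓝 m)) ∧ Tendsto (fun n => ∫ t, ‖g n t - v t‖ ^ 2) atTop (𝓝 0)) → Differentiable ℂ (Literature.NumberTheory.LFunctions.weilMellin v) ∧ ∀ s : ℂ, Literature.NumberTheory.LFunctions.weilMellin v s = 0 → s.re = 1 / 2 :=
  Iff.rfl

/-! ## The three stub statements as named propositions `Sig.stub_*` -/

namespace Sig

/-- **Stub 1 — the RESOLVENT GAP (renormalised form, direction `v`).** For `a > 0`, `lam < ε(a)`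
and a shifted-resolvent vector `v`, with `A = Re v̂(1/2)`: for every window test function `g`,
`(ε(a) − lam)·(‖g‖₂²‖v‖₂² − |⟨g, v⟩|²) ≤ ‖v‖₂² · Q'(g)`,
`Q'(g) = Re Q(g) − lam ‖g‖₂² − |ĝ(1/2)|²/A`. Why plausibly true: in `H(T_{a,λ})`,
`Q'(g) = ‖g − (ĝ(1/2)/A)v‖²_T ≥ (ε(a) − lam)‖g − (ĝ(1/2)/A)v‖₂² ≥ (ε(a) − lam)·dist₂(g, ℂv)²`
(Riesz: `⟨g, v⟩_T = ĝ(1/2)`, `‖v‖²_T = A`; coercivity `q_λ ≥ (ε − λ)‖·‖₂²`,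
tree `weilGroundEnergy_mul_le_re`); operator-free along minimising sequences with the polar
Cauchy–Schwarz bounds of `WeilGroundStateRealZerosProofs` §A/§B and the key inequality of
`WeilResolventVectorExists` §2. Analogue of `ConnesVanSuijlekom.gap_inequality`. Size M/L. -/
def stub_resolventGap : Prop :=
  ∀ (a lam : ℝ) (v : ℝ → ℂ), 0 < a → lam < weilGroundEnergy a → IsWeilResolventVector a lam v →
    ∀ g : ℝ → ℂ, IsWeilTest g → tsupport g ⊆ Icc (-a) a →
      (weilGroundEnergy a - lam) *
          ((∫ t, ‖g t‖ ^ 2) * (∫ t, ‖v t‖ ^ 2) - ‖∫ t, g t * conj (v t)‖ ^ 2) ≤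
        (∫ t, ‖v t‖ ^ 2) *
          ((weilQuadratic g).re - lam * (∫ t, ‖g t‖ ^ 2) -
            ‖weilMellin g (1 / 2)‖ ^ 2 / (weilMellin v (1 / 2)).re)

/-- **Stub 2 — PINNED MINIMISING SEQUENCE with vanishing renormalised energy.** For `a > 0`,
`lam < ε(a)`, a shifted-resolvent vector `v` and a zero `v̂(s₀) = 0`: there are window test
functions `g_m` with `ĝ_m(s₀) = 0`, `g_m → v` in `L²` and `Q'(g_m) → 0`. Why plausibly true: take
a minimising sequence of the predicate; `J_λ(g_m) → inf J_λ = −A` and `ĝ_m(1/2) → v̂(1/2) = A`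
(tree: `IsWeilResolventVector.re_weilMellin_half`, `tendsto_weilMellin`, `ae_eq_conj`), so
`Q'(g_m) = J_λ(g_m) + 2 Re ĝ_m(1/2) − |ĝ_m(1/2)|²/A → 0`; correct by vanishing multiples of a bump
`h` with `ĥ(s₀) ≠ 0` (tree `exists_isWeilTest_weilMellin_ne_zero`) as in
`ConnesVanSuijlekom.exists_modifiedSeq`. Size M. -/
def stub_modifiedSeq : Prop :=
  ∀ (a lam : ℝ) (v : ℝ → ℂ), 0 < a → lam < weilGroundEnergy a → IsWeilResolventVector a lam v →
    ∀ s₀ : ℂ, weilMellin v s₀ = 0 →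
      ∃ g : ℕ → ℝ → ℂ,
        (∀ m, IsWeilTest (g m) ∧ tsupport (g m) ⊆ Icc (-a) a ∧ weilMellin (g m) s₀ = 0) ∧
        Tendsto (fun m => ∫ t, ‖g m t - v t‖ ^ 2) atTop (𝓝 0) ∧
        Tendsto (fun m => (weilQuadratic (g m)).re - lam * (∫ t, ‖g m t‖ ^ 2) -
          ‖weilMellin (g m) (1 / 2)‖ ^ 2 / (weilMellin v (1 / 2)).re) atTop (𝓝 0)

/-- **Stub 3 — FACTOR-EXCHANGE RIGIDITY (the engine; hardest).** For `a > 0`, a shifted-resolvent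
vector `v` with `A = Re v̂(1/2) > 0` and a gap `δ > 0` for `Q'` in the direction `v`, NO pinned
sequence as in Stub 2 exists at a point `s₀` off the line `Re s₀ = 1/2`. Why plausibly true (the
continuum Connes–van Suijlekom mechanism, tree `ConnesVanSuijlekom.weilMellin_ne_zero_of_re_ne_half`
with `q ↦ Q'`): `w = s₀ − 1/2`, `x = Re w ≠ 0`; primitives `V_m = e^{-wt}∫_{-a}^t g_m e^{wτ}` are
window tests with `g_m = V_m' + wV_m` (`exists_primitive`); `k_m = V_m' − w̄V_m = g_m − 2xV_m` has
the same kernel `k_m ⋆ k̃_m = g_m ⋆ g̃_m` (`weilConv_weilReflect_deriv_sub_eq`), hence the same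
`Q`, `‖·‖₂` and `|·̂(1/2)|` (`∫k_m = −w̄∫V_m`, `∫g_m = w∫V_m`), so `Q'(k_m) = Q'(g_m) → 0`; the gap
forces `dist₂(k_m, ℂv) → 0`, and in the limit (`tendsto_primitive`) `v − 2xV = κv` a.e. with `V`
the windowed primitive of `v e^{w·}`; Volterra/Gronwall (`eq_zero_of_eq_mul_intervalIntegral`) and
Lebesgue differentiation (`ae_eq_zero_of_forall_intervalIntegral_eq_zero`) give `v = 0` a.e.,
contradicting `A > 0`. `lam` enters only through `Q'`. Size L. -/
def stub_factorExchange : Prop :=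
  ∀ (a lam : ℝ) (v : ℝ → ℂ), 0 < a → IsWeilResolventVector a lam v →
    0 < (weilMellin v (1 / 2)).re →
    ∀ δ : ℝ, 0 < δ →
      (∀ g : ℝ → ℂ, IsWeilTest g → tsupport g ⊆ Icc (-a) a →
        δ * ((∫ t, ‖g t‖ ^ 2) * (∫ t, ‖v t‖ ^ 2) - ‖∫ t, g t * conj (v t)‖ ^ 2) ≤
          (∫ t, ‖v t‖ ^ 2) *
            ((weilQuadratic g).re - lam * (∫ t, ‖g t‖ ^ 2) -
              ‖weilMellin g (1 / 2)‖ ^ 2 / (weilMellin v (1 / 2)).re)) →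
      ∀ s₀ : ℂ, s₀.re ≠ 1 / 2 →
        (∃ g : ℕ → ℝ → ℂ,
          (∀ m, IsWeilTest (g m) ∧ tsupport (g m) ⊆ Icc (-a) a ∧ weilMellin (g m) s₀ = 0) ∧
          Tendsto (fun m => ∫ t, ‖g m t - v t‖ ^ 2) atTop (𝓝 0) ∧
          Tendsto (fun m => (weilQuadratic (g m)).re - lam * (∫ t, ‖g m t‖ ^ 2) -
            ‖weilMellin (g m) (1 / 2)‖ ^ 2 / (weilMellin v (1 / 2)).re) atTop (𝓝 0)) →
        False

end Sig

/-! ## The registered stubs (signatures spelled out verbatim; `sorry` lives only here) -/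

/-- Registered stub `stub_resolventGap` (= `Sig.stub_resolventGap`, spelled out). -/
theorem stub_resolventGap :
    ∀ (a lam : ℝ) (v : ℝ → ℂ), 0 < a → lam < weilGroundEnergy a → IsWeilResolventVector a lam v →
      ∀ g : ℝ → ℂ, IsWeilTest g → tsupport g ⊆ Icc (-a) a →
        (weilGroundEnergy a - lam) *
            ((∫ t, ‖g t‖ ^ 2) * (∫ t, ‖v t‖ ^ 2) - ‖∫ t, g t * conj (v t)‖ ^ 2) ≤
          (∫ t, ‖v t‖ ^ 2) *
            ((weilQuadratic g).re - lam * (∫ t, ‖g t‖ ^ 2) -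
              ‖weilMellin g (1 / 2)‖ ^ 2 / (weilMellin v (1 / 2)).re) := by
  sorry

/-- Registered stub `stub_modifiedSeq` (= `Sig.stub_modifiedSeq`, spelled out). -/
theorem stub_modifiedSeq :
    ∀ (a lam : ℝ) (v : ℝ → ℂ), 0 < a → lam < weilGroundEnergy a → IsWeilResolventVector a lam v →
      ∀ s₀ : ℂ, weilMellin v s₀ = 0 →
        ∃ g : ℕ → ℝ → ℂ,
          (∀ m, IsWeilTest (g m) ∧ tsupport (g m) ⊆ Icc (-a) a ∧ weilMellin (g m) s₀ = 0) ∧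
          Tendsto (fun m => ∫ t, ‖g m t - v t‖ ^ 2) atTop (𝓝 0) ∧
          Tendsto (fun m => (weilQuadratic (g m)).re - lam * (∫ t, ‖g m t‖ ^ 2) -
            ‖weilMellin (g m) (1 / 2)‖ ^ 2 / (weilMellin v (1 / 2)).re) atTop (𝓝 0) := by
  sorry

/-- Registered stub `stub_factorExchange` (= `Sig.stub_factorExchange`, spelled out). -/
theorem stub_factorExchange :
    ∀ (a lam : ℝ) (v : ℝ → ℂ), 0 < a → IsWeilResolventVector a lam v →
      0 < (weilMellin v (1 / 2)).re →
      ∀ δ : ℝ, 0 < δ →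
        (∀ g : ℝ → ℂ, IsWeilTest g → tsupport g ⊆ Icc (-a) a →
          δ * ((∫ t, ‖g t‖ ^ 2) * (∫ t, ‖v t‖ ^ 2) - ‖∫ t, g t * conj (v t)‖ ^ 2) ≤
            (∫ t, ‖v t‖ ^ 2) *
              ((weilQuadratic g).re - lam * (∫ t, ‖g t‖ ^ 2) -
                ‖weilMellin g (1 / 2)‖ ^ 2 / (weilMellin v (1 / 2)).re)) →
        ∀ s₀ : ℂ, s₀.re ≠ 1 / 2 →
          (∃ g : ℕ → ℝ → ℂ,
            (∀ m, IsWeilTest (g m) ∧ tsupport (g m) ⊆ Icc (-a) a ∧ weilMellin (g m) s₀ = 0) ∧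
            Tendsto (fun m => ∫ t, ‖g m t - v t‖ ^ 2) atTop (𝓝 0) ∧
            Tendsto (fun m => (weilQuadratic (g m)).re - lam * (∫ t, ‖g m t‖ ^ 2) -
              ‖weilMellin (g m) (1 / 2)‖ ^ 2 / (weilMellin v (1 / 2)).re) atTop (𝓝 0)) →
          False := by
  sorry

/-! ## Composition (sorry-free) and the skeleton theorem -/

/-- **Composition.** Gap ∘ pinned sequence ∘ factor-exchange rigidity ⇒ the repaired crux: the
first conjunct is the tree's `IsWeilResolventVector.differentiable_weilMellin`; for the second, a
zero `s₀` with `Re s₀ ≠ 1/2` yields a pinned sequence (Stub 2) which Stub 3 excludes, the gap being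
Stub 1 with `δ = ε(a) − lam > 0` and `A > 0` the tree's `re_weilMellin_half_pos`. -/
theorem ResolventRealZerosR_of (hG : Sig.stub_resolventGap) (hM : Sig.stub_modifiedSeq)
    (hX : Sig.stub_factorExchange) : ResolventRealZerosR := by
  intro a ha lam hlam v hv
  refine ⟨hv.differentiable_weilMellin, fun s₀ hs₀ => ?_⟩
  by_contra hne
  exact hX a lam v ha hv (hv.re_weilMellin_half_pos ha) (weilGroundEnergy a - lam) (sub_pos.2 hlam)
    (hG a lam v ha hlam hv) s₀ hne (hM a lam v ha hlam hv s₀ hs₀)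

/-- **Skeleton theorem**: the repaired crux from the three registered stubs. -/
theorem ResolventRealZerosR_proof : ResolventRealZerosR :=
  ResolventRealZerosR_of stub_resolventGap stub_modifiedSeq stub_factorExchange

end Summit.RiemannHypothesis.RiemannHypothesis.Cruxes.ResolventRealZeros.BirthRepaired

end
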